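import Summits.Ventures.CertifiedManyBodySolver.Observables.SpinBox3Words
import HarnessLib

/-!
# The box-row objective WORDS in the ENGINE's convention (one 𝐒₀·𝐒_ρ per half-plane representative `ρ`, weight = twice
# the pair count), their `D₄` dictionary, and the leaf discharge — so that a certificate on p3's boxrows objective
# (kit j246317 menus; producer job kit j246664) is typed on the operator it literally carries

HONEST FRAMING: first certified bounds on pairing observables; not a superconductivity verdict; every number certified
(two lineages + referee) or labelled float.  Cell hubbard-obs (D-0042 crew 1), seat hubbard-obs-p3 (CONTROLS), gen 2.  Zero
compute; no certificate typed; no `sorry`.  A CEILING on a Bragg weight says nothing about the presence of order.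

`SpinBox3Words.lean` wrote the `3 × 3` staggered box functional on ONE representative per `D₄` class
(`spinBoxStag3Word`, support `box3ClassSupport`, 6 sites).  The engine's objective (HOME/hubbard-obs-p3/menus/…boxrows.json,
`OBJ_COMBOS_boxrows.json`) is operator-different though orbit-mean-equal: it sums the menu functional `SS_ρ = 𝐒₀·𝐒_ρ` over the
twelve HALF-PLANE representatives `ρ ∈ {(0,1),(0,2),(1,−2),(1,−1),(1,0),(1,1),(1,2),(2,−2),(2,−1),(2,0),(2,1),(2,2)}` (one per
`±` pair of displacements of the `3 × 3` box) with weight `2·N(ρ)·(−1)^{|ρ|₁}/81`, `N(ρ) = (3−|ρ₁|)(3−|ρ₂|)`, plus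
`−(1/6)·n_{0↑}n_{0↓}` and the external constant `7/96`:

  `F_s3_stag = 7/96 + ω(fs3StagEngWord)`,  `fs3StagEngWord = −(1/6)n↑n↓ − (4/27)[SS(1,0)+SS(0,1)] + (8/81)[SS(1,1)+SS(1,−1)]
  ` + (2/27)[SS(2,0)+SS(0,2)] − (4/81)[SS(2,1)+SS(2,−1)+SS(1,2)+SS(1,−2)] + (2/81)[SS(2,2)+SS(2,−2)]`;
  `F_s32_stag = 7/64 + ω(fs32StagEngWord)` (the `D₄`-symmetrised `3 × 2` box; ten representatives).

This file: the support `halfBox5Support` (13 sites), the two words (in `spinDotAt`/`nAt` form, split in parts for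
elaboration), the dictionary `(1/8)Σ_γ Re ω(Γ(γ)·word) =` the CLASS form of `BoxRowBraggCeilings`, and the leaf discharges
`M3ObsNeelCeilingAt_of_fs3StagEng_orbitRow : M3CorrOrbitLowerRow t′ u r univ halfBox5Support (−fs3StagEngWord) →
M3EnergyUpperRow t′ u → M3ObsNeelCeilingAt t′ (7/96 − r)` and `…_of_fs32StagEng_orbitRow` (`7/64 − r`).  The typer's literal
(normal-ordered) objective is bridged to these words by `spinDotAt_eq_normalOrder` exactly as `spinGsB_eq`.

References: Scalapino, Phys. Rep. 250 (1995) 329, §2.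
-/

noncomputable section

open MeasureTheory Complex Filter Topology
open scoped Real BigOperators

namespace Summit.Ventures.CertifiedManyBodySolver.Observables

open Matrix Literature.MathematicalPhysics.QuantumLattice Literature.Probability.LatticeModels
open Literature.MathematicalPhysics.QuantumLattice.ThermodynamicLimit
open HubbardWave0 Literature.MathematicalPhysics.QuantumManyBody.StateRelaxation
open Summit.HubbardSuperconductivity.ManyBodyBootstrap.Bounds
open Literature.MathematicalPhysics.QuantumLattice.FermionSpinMoment
open Summit.Ventures.CertifiedManyBodySolver.Certificates
open Summit.Ventures.CertifiedManyBodySolver.Transport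
open Summit.Ventures.CertifiedManyBodySolver.SpinStarTL
open DihedralGroup

/-! ## §1  Support and words -/

/-- The origin and the twelve half-plane representatives of the displacements of the `3 × 3` box:
`{0, (0,1), (0,2), (1,−2), (1,−1), (1,0), (1,1), (1,2), (2,−2), (2,−1), (2,0), (2,1), (2,2)}`. [cite: Scalapino1995, §2] -/
abbrev halfBox5Support : Finset (Site 2) :=
  {0, ![0, 1], ![0, 2], ![1, -2], ![1, -1], ![1, 0], ![1, 1], ![1, 2], ![2, -2], ![2, -1], ![2, 0], ![2, 1], ![2, 2]}

/-- On-site part (both box words): `n_{0↑}n_{0↓}` (weight applied in the words). [cite: Scalapino1995, §2] -/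
def engDocc : FermionOp halfBox5Support := nAt 0 (by decide) 0 * nAt 0 (by decide) 1

/-- Axial part: `SS(1,0) + SS(0,1)`. [cite: Scalapino1995, §2] -/
def engAx1 : FermionOp halfBox5Support :=
  spinDotAt 0 (by decide) ![1, 0] (by decide) + spinDotAt 0 (by decide) ![0, 1] (by decide)

/-- Diagonal part: `SS(1,1) + SS(1,−1)`. [cite: Scalapino1995, §2] -/
def engDiag : FermionOp halfBox5Support :=
  spinDotAt 0 (by decide) ![1, 1] (by decide) + spinDotAt 0 (by decide) ![1, -1] (by decide)

/-- Distance-two axial part: `SS(2,0) + SS(0,2)`. [cite: Scalapino1995, §2] -/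
def engAx2 : FermionOp halfBox5Support :=
  spinDotAt 0 (by decide) ![2, 0] (by decide) + spinDotAt 0 (by decide) ![0, 2] (by decide)

/-- Knight part: `SS(2,1) + SS(2,−1) + SS(1,2) + SS(1,−2)`. [cite: Scalapino1995, §2] -/
def engKnight : FermionOp halfBox5Support :=
  spinDotAt 0 (by decide) ![2, 1] (by decide) + spinDotAt 0 (by decide) ![2, -1] (by decide) +
  spinDotAt 0 (by decide) ![1, 2] (by decide) + spinDotAt 0 (by decide) ![1, -2] (by decide)

/-- Corner part: `SS(2,2) + SS(2,−2)`. [cite: Scalapino1995, §2] -/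
def engCorner : FermionOp halfBox5Support :=
  spinDotAt 0 (by decide) ![2, 2] (by decide) + spinDotAt 0 (by decide) ![2, -2] (by decide)

/-- **Engine-form `3 × 3` staggered box word** (`F_s3_stag − 7/96`; p3 boxrows objective `F_s3_stag`, weights = twice the pair
counts `(3−|ρ₁|)(3−|ρ₂|)` with signs `(−1)^{|ρ|₁}`, over `81`). [cite: Scalapino1995, §2] -/
def fs3StagEngWord : FermionOp halfBox5Support :=
  ((-1/6 : ℚ) : ℂ) • engDocc + ((-4/27 : ℚ) : ℂ) • engAx1 + ((8/81 : ℚ) : ℂ) • engDiag + ((2/27 : ℚ) : ℂ) • engAx2 +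
  ((-4/81 : ℚ) : ℂ) • engKnight + ((2/81 : ℚ) : ℂ) • engCorner

/-- **Engine-form `D₄`-symmetrised `3 × 2` staggered box word** (`F_s32_stag − 7/64`; boxrows objective `F_s32_stag`,
weights over `72`, no corner term). [cite: Scalapino1995, §2] -/
def fs32StagEngWord : FermionOp halfBox5Support :=
  ((-1/4 : ℚ) : ℂ) • engDocc + ((-7/36 : ℚ) : ℂ) • engAx1 + ((1/9 : ℚ) : ℂ) • engDiag + ((1/18 : ℚ) : ℂ) • engAx2 +
  ((-1/36 : ℚ) : ℂ) • engKnight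

/-! ## §2  Dictionary -/

section Dictionary

variable {ω : InfVolFermionState 2}

/-- `Re ω(Γ(γ)·engDocc) = docc`. [folklore] -/
theorem re_expect_d4_engDocc (hω : ω.IsTranslationInvariant) (g : DihedralGroup 4) :
    (ω.expect (d4ShiftSet g 0 halfBox5Support) (fermionEmbed (PolySite.d4Emb g 0 halfBox5Support) engDocc)).re =
      docc ω := by
  unfold engDocc
  simp only [map_mul, fermionEmbed_numberOp, d4Emb_pt, re_expect_nAt_mul_nAt_eq_docc hω]

/-- `Re ω(Γ(γ)·engAx1) = C_ω(γ(1,0)) + C_ω(γ(0,1))`. [folklore] -/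
theorem re_expect_d4_engAx1 (hω : ω.IsTranslationInvariant) (g : DihedralGroup 4) :
    (ω.expect (d4ShiftSet g 0 halfBox5Support) (fermionEmbed (PolySite.d4Emb g 0 halfBox5Support) engAx1)).re =
      Certificates.spinCorr ω (d4Vec g ![1, 0]) + Certificates.spinCorr ω (d4Vec g ![0, 1]) := by
  unfold engAx1
  simp only [spinDotAt, map_add, fermionEmbed_fermionSpinDot, d4Emb_pt, Complex.add_re,
    re_expect_fermionSpinDot_eq_spinCorr hω, PolySite.ofLex_coe_pt, d4Vec_zero, add_zero, sub_zero]

/-- `Re ω(Γ(γ)·engDiag) = C_ω(γ(1,1)) + C_ω(γ(1,−1))`. [folklore] -/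
theorem re_expect_d4_engDiag (hω : ω.IsTranslationInvariant) (g : DihedralGroup 4) :
    (ω.expect (d4ShiftSet g 0 halfBox5Support) (fermionEmbed (PolySite.d4Emb g 0 halfBox5Support) engDiag)).re =
      Certificates.spinCorr ω (d4Vec g ![1, 1]) + Certificates.spinCorr ω (d4Vec g ![1, -1]) := by
  unfold engDiag
  simp only [spinDotAt, map_add, fermionEmbed_fermionSpinDot, d4Emb_pt, Complex.add_re,
    re_expect_fermionSpinDot_eq_spinCorr hω, PolySite.ofLex_coe_pt, d4Vec_zero, add_zero, sub_zero]

/-- `Re ω(Γ(γ)·engAx2) = C_ω(γ(2,0)) + C_ω(γ(0,2))`. [folklore] -/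
theorem re_expect_d4_engAx2 (hω : ω.IsTranslationInvariant) (g : DihedralGroup 4) :
    (ω.expect (d4ShiftSet g 0 halfBox5Support) (fermionEmbed (PolySite.d4Emb g 0 halfBox5Support) engAx2)).re =
      Certificates.spinCorr ω (d4Vec g ![2, 0]) + Certificates.spinCorr ω (d4Vec g ![0, 2]) := by
  unfold engAx2
  simp only [spinDotAt, map_add, fermionEmbed_fermionSpinDot, d4Emb_pt, Complex.add_re,
    re_expect_fermionSpinDot_eq_spinCorr hω, PolySite.ofLex_coe_pt, d4Vec_zero, add_zero, sub_zero]

/-- `Re ω(Γ(γ)·engKnight) = C_ω(γ(2,1)) + C_ω(γ(2,−1)) + C_ω(γ(1,2)) + C_ω(γ(1,−2))`. [folklore] -/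
theorem re_expect_d4_engKnight (hω : ω.IsTranslationInvariant) (g : DihedralGroup 4) :
    (ω.expect (d4ShiftSet g 0 halfBox5Support) (fermionEmbed (PolySite.d4Emb g 0 halfBox5Support) engKnight)).re =
      Certificates.spinCorr ω (d4Vec g ![2, 1]) + Certificates.spinCorr ω (d4Vec g ![2, -1]) +
        Certificates.spinCorr ω (d4Vec g ![1, 2]) + Certificates.spinCorr ω (d4Vec g ![1, -2]) := by
  unfold engKnight
  simp only [spinDotAt, map_add, fermionEmbed_fermionSpinDot, d4Emb_pt, Complex.add_re,
    re_expect_fermionSpinDot_eq_spinCorr hω, PolySite.ofLex_coe_pt, d4Vec_zero, add_zero, sub_zero]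

/-- `Re ω(Γ(γ)·engCorner) = C_ω(γ(2,2)) + C_ω(γ(2,−2))`. [folklore] -/
theorem re_expect_d4_engCorner (hω : ω.IsTranslationInvariant) (g : DihedralGroup 4) :
    (ω.expect (d4ShiftSet g 0 halfBox5Support) (fermionEmbed (PolySite.d4Emb g 0 halfBox5Support) engCorner)).re =
      Certificates.spinCorr ω (d4Vec g ![2, 2]) + Certificates.spinCorr ω (d4Vec g ![2, -2]) := by
  unfold engCorner
  simp only [spinDotAt, map_add, fermionEmbed_fermionSpinDot, d4Emb_pt, Complex.add_re,
    re_expect_fermionSpinDot_eq_spinCorr hω, PolySite.ofLex_coe_pt, d4Vec_zero, add_zero, sub_zero]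

/-- Orbit means of the parts in class values `c = Re spinOrbitCorr ω`:
`(1/8)Σ_γ` of `engAx1, engDiag, engAx2, engKnight, engCorner` = `2c(1,0), 2c(1,1), 2c(2,0), 4c(2,1), 2c(2,2)`. [folklore] -/
theorem orbitMean_eng_parts (hω : ω.IsTranslationInvariant) :
    (8 : ℝ)⁻¹ * ∑ g : DihedralGroup 4, (ω.expect (d4ShiftSet g 0 halfBox5Support)
        (fermionEmbed (PolySite.d4Emb g 0 halfBox5Support) engAx1)).re = 2 * (spinOrbitCorr ω ![1, 0]).re ∧
    (8 : ℝ)⁻¹ * ∑ g : DihedralGroup 4, (ω.expect (d4ShiftSet g 0 halfBox5Support)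
        (fermionEmbed (PolySite.d4Emb g 0 halfBox5Support) engDiag)).re = 2 * (spinOrbitCorr ω ![1, 1]).re ∧
    (8 : ℝ)⁻¹ * ∑ g : DihedralGroup 4, (ω.expect (d4ShiftSet g 0 halfBox5Support)
        (fermionEmbed (PolySite.d4Emb g 0 halfBox5Support) engAx2)).re = 2 * (spinOrbitCorr ω ![2, 0]).re ∧
    (8 : ℝ)⁻¹ * ∑ g : DihedralGroup 4, (ω.expect (d4ShiftSet g 0 halfBox5Support)
        (fermionEmbed (PolySite.d4Emb g 0 halfBox5Support) engKnight)).re = 4 * (spinOrbitCorr ω ![2, 1]).re ∧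
    (8 : ℝ)⁻¹ * ∑ g : DihedralGroup 4, (ω.expect (d4ShiftSet g 0 halfBox5Support)
        (fermionEmbed (PolySite.d4Emb g 0 halfBox5Support) engCorner)).re = 2 * (spinOrbitCorr ω ![2, 2]).re := by
  obtain ⟨-, e2, -, -, -, e6, -, e8, -, -, -, e12, e13, -, -, e16, -, -, e19⟩ :=
    d4Invariant_box3_values (spinOrbitCorr_d4Vec ω)
  have c10 := spinOrbitCorr_re ω ![1, 0]
  have c01 := spinOrbitCorr_re ω ![0, 1]
  have c11 := spinOrbitCorr_re ω ![1, 1]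
  have c1m1 := spinOrbitCorr_re ω ![1, -1]
  have c20 := spinOrbitCorr_re ω ![2, 0]
  have c02 := spinOrbitCorr_re ω ![0, 2]
  have c21 := spinOrbitCorr_re ω ![2, 1]
  have c2m1 := spinOrbitCorr_re ω ![2, -1]
  have c12 := spinOrbitCorr_re ω ![1, 2]
  have c1m2 := spinOrbitCorr_re ω ![1, -2]
  have c22 := spinOrbitCorr_re ω ![2, 2]
  have c2m2 := spinOrbitCorr_re ω ![2, -2]
  rw [e2] at c01; rw [e6] at c1m1; rw [e8] at c02; rw [e13] at c2m1; rw [e16] at c12; rw [e12] at c1m2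
  rw [e19] at c2m2
  simp only [re_expect_d4_engAx1 hω, re_expect_d4_engDiag hω, re_expect_d4_engAx2 hω, re_expect_d4_engKnight hω,
    re_expect_d4_engCorner hω, Finset.sum_add_distrib, mul_add]
  refine ⟨by linarith, by linarith, by linarith, by linarith, by linarith⟩

/-- **Dictionary, `fs3StagEngWord`**: an orbit-mean UPPER bound `≤ q` gives the `3 × 3` class form of `BoxRowBraggCeilings`
(with the `r = 0` class as `¾(7/8 − 2·docc)`) bounded by `7/96 + q`. [folklore] -/
theorem fs3StagEng_classForm_le_of_orbitRow (hω : ω.IsTranslationInvariant) {q : ℝ}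
    (h : ((Finset.univ : Finset (DihedralGroup 4)).card : ℝ)⁻¹ *
        ∑ g ∈ (Finset.univ : Finset (DihedralGroup 4)), (ω.expect (d4ShiftSet g 0 halfBox5Support)
          (fermionEmbed (PolySite.d4Emb g 0 halfBox5Support) fs3StagEngWord)).re ≤ q) :
    (9 * (3/4 * (7/8 - 2 * docc ω)) - 24 * (spinOrbitCorr ω ![1, 0]).re + 16 * (spinOrbitCorr ω ![1, 1]).re
      + 12 * (spinOrbitCorr ω ![2, 0]).re - 16 * (spinOrbitCorr ω ![2, 1]).re + 4 * (spinOrbitCorr ω ![2, 2]).re) / 81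
      ≤ 7/96 + q := by
  obtain ⟨h1, h2, h3, h4, h5⟩ := orbitMean_eng_parts hω (ω := ω)
  have hd : ∀ g : DihedralGroup 4, (ω.expect (d4ShiftSet g 0 halfBox5Support)
      (fermionEmbed (PolySite.d4Emb g 0 halfBox5Support) engDocc)).re = docc ω := re_expect_d4_engDocc hω
  unfold fs3StagEngWord at h
  simp only [map_add, map_smul, smul_eq_mul, Complex.add_re] at h
  push_cast at h
  rw [show (-1/6 : ℂ) = ((-1/6 : ℝ) : ℂ) by norm_num, show (-4/27 : ℂ) = ((-4/27 : ℝ) : ℂ) by norm_num,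
    show (8/81 : ℂ) = ((8/81 : ℝ) : ℂ) by norm_num, show (2/27 : ℂ) = ((2/27 : ℝ) : ℂ) by norm_num,
    show (-4/81 : ℂ) = ((-4/81 : ℝ) : ℂ) by norm_num, show (2/81 : ℂ) = ((2/81 : ℝ) : ℂ) by norm_num] at h
  simp only [Complex.re_ofReal_mul, hd, Finset.sum_add_distrib, ← Finset.mul_sum, Finset.sum_const, Finset.card_univ,
    DihedralGroup.card, nsmul_eq_mul] at h
  push_cast at h
  linarith

/-- **Dictionary, `fs32StagEngWord`**: an orbit-mean UPPER bound `≤ q` gives the `3 × 2 ⊕ 2 × 3` class form bounded by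
`7/64 + q` (density `7/8`). [folklore] -/
theorem fs32StagEng_classForm_le_of_orbitRow (hω : ω.IsTranslationInvariant) (hn : ω.density = 7/8) {q : ℝ}
    (h : ((Finset.univ : Finset (DihedralGroup 4)).card : ℝ)⁻¹ *
        ∑ g ∈ (Finset.univ : Finset (DihedralGroup 4)), (ω.expect (d4ShiftSet g 0 halfBox5Support)
          (fermionEmbed (PolySite.d4Emb g 0 halfBox5Support) fs32StagEngWord)).re ≤ q) :
    (6 * (spinOrbitCorr ω ![0, 0]).re - 14 * (spinOrbitCorr ω ![1, 0]).re + 8 * (spinOrbitCorr ω ![1, 1]).re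
        + 4 * (spinOrbitCorr ω ![2, 0]).re - 4 * (spinOrbitCorr ω ![2, 1]).re) / 36 ≤ 7/64 + q := by
  obtain ⟨h1, h2, h3, h4, -⟩ := orbitMean_eng_parts hω (ω := ω)
  have hd : ∀ g : DihedralGroup 4, (ω.expect (d4ShiftSet g 0 halfBox5Support)
      (fermionEmbed (PolySite.d4Emb g 0 halfBox5Support) engDocc)).re = docc ω := re_expect_d4_engDocc hω
  rw [spinOrbitCorr_re_zero hω hn]
  unfold fs32StagEngWord at h
  simp only [map_add, map_smul, smul_eq_mul, Complex.add_re] at h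
  push_cast at h
  rw [show (-1/4 : ℂ) = ((-1/4 : ℝ) : ℂ) by norm_num, show (-7/36 : ℂ) = ((-7/36 : ℝ) : ℂ) by norm_num,
    show (1/9 : ℂ) = ((1/9 : ℝ) : ℂ) by norm_num, show (1/18 : ℂ) = ((1/18 : ℝ) : ℂ) by norm_num,
    show (-1/36 : ℂ) = ((-1/36 : ℝ) : ℂ) by norm_num] at h
  simp only [Complex.re_ofReal_mul, hd, Finset.sum_add_distrib, ← Finset.mul_sum, Finset.sum_const, Finset.card_univ,
    DihedralGroup.card, nsmul_eq_mul] at h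
  push_cast at h
  linarith

end Dictionary

/-! ## §3  Leaf discharges -/

section Leaves

/-- **Engine-form orbit row ⇒ Néel ceiling (`3 × 3`)**: `M3CorrOrbitLowerRow t′ u r univ halfBox5Support (−fs3StagEngWord)`
(i.e. `F_s3_stag ≤ 7/96 − r`, GIVEN `e₀ ≤ u`) and `M3EnergyUpperRow t′ u` give `M3ObsNeelCeilingAt t′ (7/96 − r)` — the
reading of p3's `FS3Sup` certificates (kit j246664) once typed. [cite: Scalapino1995, §2] -/
theorem M3ObsNeelCeilingAt_of_fs3StagEng_orbitRow {tp : ℝ} {u r : ℚ}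
    (hrow : M3CorrOrbitLowerRow tp u r Finset.univ halfBox5Support (-fs3StagEngWord))
    (hE : M3EnergyUpperRow tp u) :
    M3ObsNeelCeilingAt tp (7/96 - r) := by
  intro ω Ls ψ hLs hψ hψ1 hlim μ hfin hμ
  obtain ⟨hω, -⟩ := m3_rowState_invariances hLs hψ hψ1 hlim
  have h := hrow ω Ls ψ hLs hψ hψ1 hlim hE
  simp only [map_neg, Complex.neg_re, Finset.sum_neg_distrib, mul_neg] at h
  have h' := fs3StagEng_classForm_le_of_orbitRow hω (le_neg.1 h)
  refine neel_braggWeight_le_of_boxStag3_classRow ω μ Ls ψ hLs hψ hψ1 hlim ?_ hμ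
  rw [spinOrbitCorr_re ω ![1, 0], spinOrbitCorr_re ω ![1, 1], spinOrbitCorr_re ω ![2, 0], spinOrbitCorr_re ω ![2, 1],
    spinOrbitCorr_re ω ![2, 2]] at h'
  linarith

/-- **Engine-form orbit row ⇒ Néel ceiling (`3 × 2 ⊕ 2 × 3`)**: `M3CorrOrbitLowerRow t′ u r univ halfBox5Support
(−fs32StagEngWord)` and `M3EnergyUpperRow t′ u` give `M3ObsNeelCeilingAt t′ (7/64 − r)` (p3's `FS32Sup` certificate).
[cite: Scalapino1995, §2] -/
theorem M3ObsNeelCeilingAt_of_fs32StagEng_orbitRow {tp : ℝ} {u r : ℚ}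
    (hrow : M3CorrOrbitLowerRow tp u r Finset.univ halfBox5Support (-fs32StagEngWord))
    (hE : M3EnergyUpperRow tp u) :
    M3ObsNeelCeilingAt tp (7/64 - r) := by
  intro ω Ls ψ hLs hψ hψ1 hlim μ hfin hμ
  obtain ⟨hω, hn⟩ := m3_rowState_invariances hLs hψ hψ1 hlim
  have h := hrow ω Ls ψ hLs hψ hψ1 hlim hE
  simp only [map_neg, Complex.neg_re, Finset.sum_neg_distrib, mul_neg] at h
  have h' := fs32StagEng_classForm_le_of_orbitRow hω hn (le_neg.1 h)
  have hb := neel_braggWeight_le_box32sym μ ω hμ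
  linarith

end Leaves

end Summit.Ventures.CertifiedManyBodySolver.Observables

end
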